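import Literature.MathematicalPhysics.QuantumFieldTheory.Balaban1983to89.B4Cor23ZeroTorus
import Literature.MathematicalPhysics.QuantumFieldTheory.Balaban1983to89.B1Cor23ZeroFieldTorus
import Literature.MathematicalPhysics.QuantumFieldTheory.Balaban1983to89.B1Ineq225DerivZeroFieldTorus

/-!
# `Balaban1983to89.B1Cor23DictZeroFieldTorus` — T. Bałaban, *(Higgs)₂,₃ quantum fields in a finite volume. I. A lower bound*, Commun. Math.
# Phys. **85** (1982) 603–626 [Balaban1982Higgs1] with *Regularity and decay of lattice Green's functions*, Commun. Math. Phys. **89** (1983)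
# 571–597 [Balaban1983RegularityDecay]: the DICTIONARY for the four `L²` pairings of [B4] Corollary 2.3 (2.30) on the (Higgs)₂,₃ carrier at
# zero field — bond scalar products, the covariant derivative of `G^ε_k(T_ε,0)g`, and THE ADJOINT COVARIANT DERIVATIVE `D^{ε*}_0` (explicit
# formula + its adjointness identity) read on the level-`k` `Setup` torus (file 1 of 2 of the model instance; file 2 = `B1Cor23DerivZeroFieldTorus`)

statement-level skeleton of published theorems with citation tags; proofs where landed; nothing here is a claim about the Yang–Mills mass gap

PDF held: `paper:balaban1982-cmp85-higgs23-i` (journal page = PDF page + 602), p. 604 [PDF 2] ((1.3)–(1.5)), p. 605 [PDF 3] ((1.7)–(1.8),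
(1.11)), p. 610 [PDF 8] ((2.20), (2.22), (2.25)); `paper:balaban1983-cmp89-regularity-decay`, p. 580 [PDF 10] (Cor. 2.3 (2.30)), p. 581
[PDF 11]; materialised and read by this seat (gen 9/10).

CITATION HEADER (lean-in-tree rule).  Cell `lit-balaban` (HOME `run/shared/lean/pub/lit-balaban/`), Phase-2 proof seat **p14** gen 10 (unit
`lit-balaban-p14`), file 3 of the gen; SKELETON rows **B4.Cor2.3** ((2.30) MODEL INSTANCE on the (Higgs)₂,₃ carrier at `A = 0`, owner r01) and
**B1.Prop2.1** ((2.25)-type `L²` decay of `G^ε_k(T_ε,0)` and its covariant derivatives, owner r14).  The sequel of gen 9's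
`B1Cor23ZeroFieldTorus.propagatorK_pairing_bound` (FIRST pairing only, by Schur's test, under a mass cap `L^kε ≦ ε₀`): here all four pairings
come from the TORUS Combes–Thomas theorem `B4Cor23ZeroTorus.pairing_G/DG/GDt/DGDt` (this seat, files 1–2 of the gen) transported through gen 8/9's
ONE-LATTICE-TWO-FORMALIZATIONS dictionaries.  USED BY NAME, never restated: `B1Eq211ZeroFieldTorusLevels.{setupAt, eSiteAt, cmpAt, cmpAt_apply,
eSiteAt_symm_unshift, mesh_zero_eq_at, spacing_top, le_range_at}`, `B1Eq220ZeroFieldTorusLevels.{cmpAt_propagatorK, T_eq_tdist_symm}`,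
`B1Ineq225DerivZeroFieldTorus.sderiv_propagatorK_apply_at`, `B1Cor23ZeroFieldTorus.{siteInner_eq_sum_dot, sum_sq_cmpAt_eq}`,
`B1Eq211ZeroFieldTorus.transpose_deriv_mulVec`, `B5Display136Torus.G_eq_smul_Grs`, `HiggsCovariancePos.{sum_site_dir, shiftEquiv}`, the typer's
`HiggsLattice.{siteInner, bondInner, covDeriv, sderiv, covDeriv_zero, Site.tdist}`, `HiggsCovariance.propagatorK`.

WHAT IS PRINTED (verbatim).  B4 p. 580 [PDF 10]: *"Corollary 2.3. If Ω and A are as in Proposition I.2.1, then there exist positive constants c₀,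
δ₀ such that for arbitrary scalar field configurations f, f′ defined on Ω, we have |⟨f, G_k(Ω,A)f′⟩|, |⟨f, D^η_{A,μ}G_k(Ω,A)f′⟩|,
|⟨f, G_k(Ω,A)D^{η*}_{A,ν}f′⟩|, |⟨f, D^η_{A,μ}G_k(Ω,A)D^{η*}_{A,ν}f′⟩| ≦ c₀e^{−δ₀dist(supp f, supp f′)}‖f‖₂‖f′‖₂. (2.30)"*; p. 581: *"Let us notice
also that now there are no restrictions on supports of f, f′"*.  B1 p. 604 [PDF 2]: *"⟨f, g⟩ = Σ_x ε^d f(x)·g(x) (1.5)"* for functions *"defined on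
the points of the lattice … or on the bonds of this lattice"* (p. 607); p. 605 [PDF 3]: *"(D^ε_Aφ)(b) = ε^{−1}(U(A_b)φ(b₊) − φ(b₋)) (1.7)"*,
*"⟨φ, (−Δ^ε_A)φ⟩ = Σ_b ε^d|(D^ε_Aφ)(b)|² (1.8)"* with *"−Δ^ε = ∂^{ε*}∂^ε"* (after (1.11)); p. 610 [PDF 8]: *"G^ε_k(Ω, A) = (−Δ^{ε,N}_{A,Ω} + m² +
a_k(L^kε)^{−2}P_k(A))^{−1} (2.20)"*, *"the rescaled propagator is given by G_k(Ω, A) = (−Δ^{η,N}_{A,Ω} + m²(L^kε)² + a_kP_k(A))^{−1} (2.22)"*.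

DICTIONARY.  `G^ε_k(T_ε,0) = propagatorK C univ 0 m² a k` (the typer's; at `A = 0` every coupling `C` gives the same operator); `D^ε_0 = covDeriv C 0
= sderiv` (`covDeriv_zero`); the ADJOINT `D^{ε*}_0` of `D^ε_0` for the scalar products (1.5) on sites and bonds (same weight `ε^d`) is the explicit
site field `(D^{ε*}_0h)(x) = ε^{−1}Σ_ν (h(⟨x − εe_ν, x⟩) − h(⟨x, x + εe_ν⟩))` — written out as a lambda in the statements and CERTIFIED by
`siteInner_adjDeriv` (`⟨φ, D^{ε*}_0h⟩ = ⟨D^ε_0φ, h⟩` for all `φ`); bond test functions `h : bonds → ℝ^N` (all directions at once: the printed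
`D^η_{A,μ}` with `μ` fixed is the case of `h` supported on `μ`-bonds); `dist(supp h, supp g′) ↦` any `R` with `R ≦ |b₋ − x′|` ((1.3), lattice
units of `T_ε`) on the supports; the exponent `R/L^k = (L^kε)^{−1}·εR` is the printed `(L^kε)^{−1}dist` of (2.25); under `cmpAt` the model's
objects read on the level-`k` `Setup` torus `Q = setupAt S k` (`η = L^{−k}`, `ε = (L^kε)η`): `cmp_i(G^ε_kg) = (L^kε)²G_k^{resc}cmp_ig`,
`cmp_i((D^ε_0G^ε_kg)_μ) = (L^kε)(∂^η_μG_k^{resc})cmp_ig`, `cmp_i(D^{ε*}_0h) = (L^kε)^{−1}Σ_ν(∂^η_ν)ᵀcmp_ih_ν`.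

WHAT THIS FILE PROVES (kernel-checked, zero `sorry`, theorems only; axioms standard).
* §1 dictionary: `eps_setupAt`, `G_top_eq_Grs` (at the top level of `setupAt S k` the tower's `G_k` IS `G_k^{resc}`), `bondInner_eq_sum_siteInner`,
  `bondInner_eq_sum_dot`, `sum_sq_cmpAt_bond_eq`, `cmpAt_covDeriv_propagatorK` (`cmp_i((D^ε_0G^ε_kg)_μ) = (L^kε)(∂^η_μG_k^{resc})cmp_ig`),
  **`siteInner_adjDeriv`** (`⟨φ, D^{ε*}_0h⟩_{sites} = ⟨D^ε_0φ, h⟩_{bonds}` for the explicit `(D^{ε*}_0h)(x) = ε^{−1}Σ_ν(h(⟨x − εe_ν, x⟩) −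
  h(⟨x, x + εe_ν⟩))`: the certification that this lambda IS the (1.5)-adjoint of (1.7) at `A = 0`), `cmpAt_adjDeriv` (`cmp_i(D^{ε*}_0h) =
  (L^kε)^{−1}Σ_ν(∂^η_ν)ᵀcmp_ih_ν`), `cmpAt_propagatorK_adjDeriv`, `cmpAt_covDeriv_propagatorK_adjDeriv` (`cmp_i((D^ε_0G^ε_kD^{ε*}_0h)_μ) =
  Σ_ν(∂^η_μG_k^{resc}(∂^η_ν)ᵀ)cmp_ih_ν`), `abs_sum_le_of_terms` (Cauchy–Schwarz bookkeeping);
* §2 `sqrt_scale` (the weight `ε^d` leaves the normalised pairing), `sep_transport` (supports `≧ R` apart in (1.3) ⇒ `R/L^k ≦ distX` on the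
  level-`k` torus).
HONEST SCOPE.  Identities only (`A = 0`, the sub-family `M·L′_μ = L^m`, `L` odd, levels `1 ≦ k ≦ K`); no new definition: `D^{ε*}_0` is the explicit
lambda above wherever it occurs; the estimates are in file 2; nothing here is summit progress.
-/

open scoped BigOperators InnerProductSpace
open Matrix

namespace Literature.MathematicalPhysics.QuantumFieldTheory.Balaban1983to89.B1Cor23DictZeroFieldTorus

open Literature.MathematicalPhysics.QuantumFieldTheory.Balaban1983to89.HiggsLattice (ChargeData siteInner bondInner covDeriv sderiv
  covDeriv_zero)
open Literature.MathematicalPhysics.QuantumFieldTheory.Balaban1983to89.HiggsCovariance (propagatorK)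
open Literature.MathematicalPhysics.QuantumFieldTheory.Balaban1983to89.HiggsCovariancePos (sum_site_dir shiftEquiv)
open Literature.MathematicalPhysics.QuantumFieldTheory.Balaban1983to89.B1RG242Torus (tower deriv)
open Literature.MathematicalPhysics.QuantumFieldTheory.Balaban1983to89.B5Display136Torus (Grs G_eq_smul_Grs)
open Literature.MathematicalPhysics.QuantumFieldTheory.Balaban1983to89.B5Ineq137Torus (T T_nonneg distX)
open Literature.MathematicalPhysics.QuantumFieldTheory.Balaban1983to89.B5CombesThomasTorus (nsq nsq_nonneg)
open Literature.MathematicalPhysics.QuantumFieldTheory.Balaban1983to89.B1Eq211ZeroFieldTorus (Shape transpose_deriv_mulVec)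
open Literature.MathematicalPhysics.QuantumFieldTheory.Balaban1983to89.B1Eq211ZeroFieldTorusLevels (setupAt setupAt_d setupAt_L
  eSiteAt cmpAt cmpAt_apply eSiteAt_symm_unshift mesh_zero_eq_at spacing_top le_range_at)
open Literature.MathematicalPhysics.QuantumFieldTheory.Balaban1983to89.B1Eq220ZeroFieldTorusLevels (cmpAt_propagatorK T_eq_tdist_symm)
open Literature.MathematicalPhysics.QuantumFieldTheory.Balaban1983to89.B1Ineq225DerivZeroFieldTorus (sderiv_propagatorK_apply_at)
open Literature.MathematicalPhysics.QuantumFieldTheory.Balaban1983to89.B1Cor23ZeroFieldTorus (siteInner_eq_sum_dot sum_sq_cmpAt_eq)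
open Literature.MathematicalPhysics.QuantumFieldTheory.Balaban1983to89.B4Cor23ZeroTorus (pairing_G pairing_DG pairing_GDt pairing_DGDt)

variable {P : HiggsLattice.Params}

/-! ## §1 The dictionary for bond fields, covariant derivatives and the adjoint derivative at zero field -/

section Dictionary

variable (S : Shape P) {k : ℕ} (hk : k ≤ P.K) {N : ℕ}

/-- `setupAt`'s fine spacing is `η = L^{−k}` ((2.22): *"rescaled to the η-lattice, η = L^{−k}"*). [cite: Balaban1982Higgs1, (2.22) p.610] -/
theorem eps_setupAt (k : ℕ) : (setupAt S k).eps = ((P.L : ℝ) ^ k)⁻¹ := by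
  show ((P.L : ℝ)⁻¹) ^ k = ((P.L : ℝ) ^ k)⁻¹
  rw [inv_pow]

/-- At the top level of `setupAt S k` the tower's `G_k` IS the rescaled operator (2.22): `G_k = (L^kη)²G_k^{resc} = G_k^{resc}` (`L^kη = 1`).
[cite: Balaban1982Higgs1, (2.22) p.610] -/
theorem G_top_eq_Grs {a m' : ℝ} (ha : 0 < a) (hm : 0 ≤ m') (hk1 : 1 ≤ k) :
    (tower (setupAt S k) a m').G k = Grs (setupAt S k) a m' k := by
  rw [G_eq_smul_Grs (P := setupAt S k) ha hm hk1, spacing_top, one_pow, one_smul]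

/-- The bond scalar product (1.5) is the sum over directions of the site scalar products of the components `h_μ(x) = h(⟨x, x+εe_μ⟩)`.
[cite: Balaban1982Higgs1, (1.5) p.604] -/
theorem bondInner_eq_sum_siteInner (h g : HiggsLattice.PBond P 0 → EuclideanSpace ℝ (Fin N)) :
    bondInner h g = ∑ μ : Fin P.d, siteInner (fun x => h ⟨x, μ⟩) (fun x => g ⟨x, μ⟩) := by
  unfold HiggsLattice.bondInner HiggsLattice.siteInner
  rw [Finset.sum_comm]
  exact (sum_site_dir (fun x μ => P.mesh 0 ^ P.d * ⟪h ⟨x, μ⟩, g ⟨x, μ⟩⟫_ℝ)).symm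

/-- **The bond scalar product through the components on the level-`k` torus**: `⟨h, g⟩ = ε^dΣ_μΣ_i cmp_ih_μ ⬝ᵥ cmp_ig_μ`.
[cite: Balaban1982Higgs1, (1.5) p.604] -/
theorem bondInner_eq_sum_dot (h g : HiggsLattice.PBond P 0 → EuclideanSpace ℝ (Fin N)) :
    bondInner h g = P.mesh 0 ^ P.d * ∑ μ : Fin P.d, ∑ i : Fin N,
      (cmpAt S hk i (fun x => h ⟨x, μ⟩) ⬝ᵥ cmpAt S hk i (fun x => g ⟨x, μ⟩)) := by
  rw [bondInner_eq_sum_siteInner, Finset.mul_sum]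
  exact Finset.sum_congr rfl fun μ _ => siteInner_eq_sum_dot S hk _ _

/-- `Σ_μΣ_iΣ_z (cmp_ih_μ)(z)² = ε^{−d}⟨h, h⟩` for a bond field. [cite: Balaban1982Higgs1, (1.5) p.604] -/
theorem sum_sq_cmpAt_bond_eq (h : HiggsLattice.PBond P 0 → EuclideanSpace ℝ (Fin N)) :
    ∑ μ : Fin P.d, ∑ i : Fin N, nsq (setupAt S k) (cmpAt S hk i (fun x => h ⟨x, μ⟩)) = (P.mesh 0 ^ P.d)⁻¹ * bondInner h h := by
  rw [bondInner_eq_sum_siteInner, Finset.mul_sum]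
  refine Finset.sum_congr rfl fun μ _ => ?_
  rw [← sum_sq_cmpAt_eq S hk]
  rfl

/-- **The covariant derivative of `G^ε_kg` read on the level-`k` torus**: `cmp_i((D^ε_0G^ε_kg)_μ) = (L^kε)·(∂^η_μG_k^{resc})cmp_ig`
(`sderiv_propagatorK_apply_at` with `G_k = G_k^{resc}` at the top level). [cite: Balaban1982Higgs1, (1.7) p.605, (2.22) p.610] -/
theorem cmpAt_covDeriv_propagatorK (C : ChargeData N) {msq a : ℝ} (hk1 : 1 ≤ k) (ha : 0 < a) (hmsq : 0 ≤ msq)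
    (g : HiggsLattice.ScalarField P 0 N) (μ : Fin P.d) (i : Fin N) :
    cmpAt S hk i (fun x => covDeriv C (0 : HiggsLattice.VecField P 0)
        (propagatorK C Finset.univ (0 : HiggsLattice.VecField P 0) msq a k g) ⟨x, μ⟩)
      = P.mesh k • ((deriv (setupAt S k) 0 ((P.L : ℝ) ^ k)⁻¹ μ * Grs (setupAt S k) a (msq * P.mesh k ^ 2) k) *ᵥ cmpAt S hk i g) := by
  funext z
  have hm' : 0 ≤ msq * P.mesh k ^ 2 := mul_nonneg hmsq (sq_nonneg _)
  rw [cmpAt_apply, covDeriv_zero, sderiv_propagatorK_apply_at S hk C hk1 ha hmsq, Equiv.apply_symm_apply, Pi.smul_apply, smul_eq_mul,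
    eps_setupAt, G_top_eq_Grs S ha hm' hk1]

/-- **THE ADJOINT COVARIANT DERIVATIVE AT ZERO FIELD** — certification of the formula: for every `φ`,
`⟨φ, D^{ε*}_0h⟩_{sites} = ⟨D^ε_0φ, h⟩_{bonds}` with `(D^{ε*}_0h)(x) = ε^{−1}Σ_ν(h(⟨x − εe_ν, x⟩) − h(⟨x, x + εe_ν⟩))` — the adjoint of (1.7)
for the scalar products (1.5) (*"−Δ^ε = ∂^{ε*}∂^ε"*, p. 605). [cite: Balaban1982Higgs1, (1.7)–(1.8) p.605, (1.5) p.604] -/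
theorem siteInner_adjDeriv (C : ChargeData N) (φ : HiggsLattice.ScalarField P 0 N) (h : HiggsLattice.PBond P 0 → EuclideanSpace ℝ (Fin N)) :
    siteInner φ (fun x => (P.mesh 0)⁻¹ • ∑ ν : Fin P.d, (h ⟨x.unshift ν, ν⟩ - h ⟨x, ν⟩))
      = bondInner (covDeriv C (0 : HiggsLattice.VecField P 0) φ) h := by
  unfold HiggsLattice.siteInner HiggsLattice.bondInner
  rw [← sum_site_dir (fun x ν => P.mesh 0 ^ P.d * ⟪covDeriv C (0 : HiggsLattice.VecField P 0) φ ⟨x, ν⟩, h ⟨x, ν⟩⟫_ℝ)]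
  have hL : ∀ x : HiggsLattice.Site P 0,
      P.mesh 0 ^ P.d * ⟪φ x, (P.mesh 0)⁻¹ • ∑ ν : Fin P.d, (h ⟨x.unshift ν, ν⟩ - h ⟨x, ν⟩)⟫_ℝ
        = P.mesh 0 ^ P.d * (P.mesh 0)⁻¹ *
            ∑ ν : Fin P.d, (⟪φ x, h ⟨x.unshift ν, ν⟩⟫_ℝ - ⟪φ x, h ⟨x, ν⟩⟫_ℝ) := by
    intro x
    rw [real_inner_smul_right, inner_sum]
    simp_rw [inner_sub_right]
    ring
  have hR : ∀ (x : HiggsLattice.Site P 0) (ν : Fin P.d),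
      P.mesh 0 ^ P.d * ⟪covDeriv C (0 : HiggsLattice.VecField P 0) φ ⟨x, ν⟩, h ⟨x, ν⟩⟫_ℝ
        = P.mesh 0 ^ P.d * (P.mesh 0)⁻¹ * (⟪φ (x.shift ν), h ⟨x, ν⟩⟫_ℝ - ⟪φ x, h ⟨x, ν⟩⟫_ℝ) := by
    intro x ν
    rw [covDeriv_zero, HiggsLattice.sderiv, real_inner_smul_left, inner_sub_left]
    show P.mesh 0 ^ P.d * ((P.mesh 0)⁻¹ * (⟪φ (x.shift ν), h ⟨x, ν⟩⟫_ℝ - ⟪φ x, h ⟨x, ν⟩⟫_ℝ)) = _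
    ring
  -- reindex the shifted sum: `Σ_xΣ_ν ⟪φ x, h(x − e_ν)⟫ = Σ_xΣ_ν ⟪φ(x + e_ν), h(x)⟫`
  have key : ∑ x : HiggsLattice.Site P 0, ∑ ν : Fin P.d, ⟪φ x, h ⟨x.unshift ν, ν⟩⟫_ℝ
      = ∑ x : HiggsLattice.Site P 0, ∑ ν : Fin P.d, ⟪φ (x.shift ν), h ⟨x, ν⟩⟫_ℝ := by
    rw [Finset.sum_comm]
    conv_rhs => rw [Finset.sum_comm]
    refine Finset.sum_congr rfl fun ν _ => ?_
    exact (Fintype.sum_equiv (shiftEquiv P 0 ν) (fun y => ⟪φ (y.shift ν), h ⟨y, ν⟩⟫_ℝ)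
      (fun x => ⟪φ x, h ⟨x.unshift ν, ν⟩⟫_ℝ) fun y => by
        show ⟪φ (y.shift ν), h ⟨y, ν⟩⟫_ℝ = ⟪φ (y.shift ν), h ⟨(y.shift ν).unshift ν, ν⟩⟫_ℝ
        rw [HiggsCovariancePos.unshift_shift]).symm
  calc ∑ x : HiggsLattice.Site P 0,
        P.mesh 0 ^ P.d * ⟪φ x, (P.mesh 0)⁻¹ • ∑ ν : Fin P.d, (h ⟨x.unshift ν, ν⟩ - h ⟨x, ν⟩)⟫_ℝ
      = P.mesh 0 ^ P.d * (P.mesh 0)⁻¹ *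
          ∑ x : HiggsLattice.Site P 0, ∑ ν : Fin P.d, (⟪φ x, h ⟨x.unshift ν, ν⟩⟫_ℝ - ⟪φ x, h ⟨x, ν⟩⟫_ℝ) := by
        rw [Finset.mul_sum]
        exact Finset.sum_congr rfl fun x _ => hL x
    _ = P.mesh 0 ^ P.d * (P.mesh 0)⁻¹ *
          ∑ x : HiggsLattice.Site P 0, ∑ ν : Fin P.d, (⟪φ (x.shift ν), h ⟨x, ν⟩⟫_ℝ - ⟪φ x, h ⟨x, ν⟩⟫_ℝ) := by
        simp only [Finset.sum_sub_distrib, key]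
    _ = ∑ x : HiggsLattice.Site P 0, ∑ ν : Fin P.d,
          P.mesh 0 ^ P.d * ⟪covDeriv C (0 : HiggsLattice.VecField P 0) φ ⟨x, ν⟩, h ⟨x, ν⟩⟫_ℝ := by
        rw [Finset.mul_sum]
        refine Finset.sum_congr rfl fun x _ => ?_
        rw [Finset.mul_sum]
        exact Finset.sum_congr rfl fun ν _ => (hR x ν).symm

/-- **The adjoint derivative read on the level-`k` torus**: `cmp_i(D^{ε*}_0h) = (L^kε)^{−1}Σ_ν(∂^η_ν)ᵀcmp_ih_ν` (`ε = (L^kε)η`; the transpose of the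
forward `η`-difference is `z ↦ η^{−1}(f(z − e_ν) − f(z))`). [cite: Balaban1982Higgs1, (1.7) p.605, (2.22) p.610] -/
theorem cmpAt_adjDeriv (h : HiggsLattice.PBond P 0 → EuclideanSpace ℝ (Fin N)) (i : Fin N) :
    cmpAt S hk i (fun x => (P.mesh 0)⁻¹ • ∑ ν : Fin P.d, (h ⟨x.unshift ν, ν⟩ - h ⟨x, ν⟩))
      = (P.mesh k)⁻¹ • ∑ ν : Fin P.d, ((deriv (setupAt S k) 0 ((P.L : ℝ) ^ k)⁻¹ ν)ᵀ *ᵥ cmpAt S hk i (fun x => h ⟨x, ν⟩)) := by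
  funext z
  have h0 : P.mesh 0 = P.mesh k * ((P.L : ℝ) ^ k)⁻¹ := by rw [mesh_zero_eq_at S k, eps_setupAt]
  rw [cmpAt_apply, Pi.smul_apply, Finset.sum_apply, smul_eq_mul]
  simp only [PiLp.smul_apply, smul_eq_mul, WithLp.ofLp_sum, Finset.sum_apply, WithLp.ofLp_sub, Pi.sub_apply]
  simp_rw [transpose_deriv_mulVec, cmpAt_apply, eSiteAt_symm_unshift]
  rw [h0, mul_inv, inv_inv, Finset.mul_sum, Finset.mul_sum]
  refine Finset.sum_congr rfl fun ν _ => ?_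
  ring

/-- `cmp_i(G^ε_kD^{ε*}_0h) = (L^kε)·Σ_ν(G_k^{resc}(∂^η_ν)ᵀ)cmp_ih_ν`. [cite: Balaban1982Higgs1, (2.20) p.610, (2.22) p.610] -/
theorem cmpAt_propagatorK_adjDeriv (C : ChargeData N) {msq a : ℝ} (hk1 : 1 ≤ k) (ha : 0 < a) (hmsq : 0 ≤ msq)
    (h : HiggsLattice.PBond P 0 → EuclideanSpace ℝ (Fin N)) (i : Fin N) :
    cmpAt S hk i (propagatorK C Finset.univ (0 : HiggsLattice.VecField P 0) msq a k
        (fun x => (P.mesh 0)⁻¹ • ∑ ν : Fin P.d, (h ⟨x.unshift ν, ν⟩ - h ⟨x, ν⟩)))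
      = P.mesh k • ∑ ν : Fin P.d, ((Grs (setupAt S k) a (msq * P.mesh k ^ 2) k * (deriv (setupAt S k) 0 ((P.L : ℝ) ^ k)⁻¹ ν)ᵀ)
          *ᵥ cmpAt S hk i (fun x => h ⟨x, ν⟩)) := by
  have hm' : 0 ≤ msq * P.mesh k ^ 2 := mul_nonneg hmsq (sq_nonneg _)
  have hℓ : P.mesh k ≠ 0 := (P.mesh_pos k).ne'
  rw [cmpAt_propagatorK S hk C hk1 ha hmsq, G_top_eq_Grs S ha hm' hk1, cmpAt_adjDeriv S hk, Matrix.mulVec_smul, Matrix.mulVec_sum,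
    smul_smul, show P.mesh k ^ 2 * (P.mesh k)⁻¹ = P.mesh k by field_simp]
  congr 1
  refine Finset.sum_congr rfl fun ν _ => ?_
  rw [Matrix.mulVec_mulVec]

/-- `cmp_i((D^ε_0G^ε_kD^{ε*}_0h)_μ) = Σ_ν(∂^η_μG_k^{resc}(∂^η_ν)ᵀ)cmp_ih_ν` — the zeroth-order operator, no power of `L^kε`.
[cite: Balaban1982Higgs1, (1.7) p.605, (2.20) p.610, (2.22) p.610] -/
theorem cmpAt_covDeriv_propagatorK_adjDeriv (C : ChargeData N) {msq a : ℝ} (hk1 : 1 ≤ k) (ha : 0 < a) (hmsq : 0 ≤ msq)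
    (h : HiggsLattice.PBond P 0 → EuclideanSpace ℝ (Fin N)) (μ : Fin P.d) (i : Fin N) :
    cmpAt S hk i (fun x => covDeriv C (0 : HiggsLattice.VecField P 0)
        (propagatorK C Finset.univ (0 : HiggsLattice.VecField P 0) msq a k
          (fun x => (P.mesh 0)⁻¹ • ∑ ν : Fin P.d, (h ⟨x.unshift ν, ν⟩ - h ⟨x, ν⟩))) ⟨x, μ⟩)
      = ∑ ν : Fin P.d, ((deriv (setupAt S k) 0 ((P.L : ℝ) ^ k)⁻¹ μ * Grs (setupAt S k) a (msq * P.mesh k ^ 2) k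
          * (deriv (setupAt S k) 0 ((P.L : ℝ) ^ k)⁻¹ ν)ᵀ) *ᵥ cmpAt S hk i (fun x => h ⟨x, ν⟩)) := by
  have hm' : 0 ≤ msq * P.mesh k ^ 2 := mul_nonneg hmsq (sq_nonneg _)
  have hℓ : P.mesh k ≠ 0 := (P.mesh_pos k).ne'
  set ψ : HiggsLattice.ScalarField P 0 N := fun x => (P.mesh 0)⁻¹ • ∑ ν : Fin P.d, (h ⟨x.unshift ν, ν⟩ - h ⟨x, ν⟩) with hψ
  funext z
  rw [cmpAt_apply, covDeriv_zero, sderiv_propagatorK_apply_at S hk C hk1 ha hmsq, Equiv.apply_symm_apply, eps_setupAt,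
    G_top_eq_Grs S ha hm' hk1, ← Matrix.mulVec_mulVec]
  have hG : Grs (setupAt S k) a (msq * P.mesh k ^ 2) k *ᵥ cmpAt S hk i ψ
      = (P.mesh k)⁻¹ • ∑ ν : Fin P.d, ((Grs (setupAt S k) a (msq * P.mesh k ^ 2) k * (deriv (setupAt S k) 0 ((P.L : ℝ) ^ k)⁻¹ ν)ᵀ)
          *ᵥ cmpAt S hk i (fun x => h ⟨x, ν⟩)) := by
    rw [hψ, cmpAt_adjDeriv S hk, Matrix.mulVec_smul, Matrix.mulVec_sum]
    congr 1
    refine Finset.sum_congr rfl fun ν _ => ?_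
    rw [Matrix.mulVec_mulVec]
  rw [hG, Matrix.mulVec_smul, Pi.smul_apply, smul_eq_mul, ← mul_assoc, mul_inv_cancel₀ hℓ, one_mul, Matrix.mulVec_sum,
    Finset.sum_apply, Finset.sum_apply]
  refine Finset.sum_congr rfl fun ν _ => ?_
  rw [Matrix.mulVec_mulVec, ← Matrix.mul_assoc]

/-- Cauchy–Schwarz bookkeeping: termwise bounds `|t_j| ≦ B√a_j√b_j` sum to `|Σ_jt_j| ≦ B√(Σa)√(Σb)`. [cite: Balaban1983RegularityDecay, Cor. 2.3
(2.30) p.580 (the `L²` norms)] -/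
theorem abs_sum_le_of_terms {ι : Type*} [Fintype ι] (t a b : ι → ℝ) {B : ℝ} (hB : 0 ≤ B) (ha : ∀ j, 0 ≤ a j) (hb : ∀ j, 0 ≤ b j)
    (h : ∀ j, |t j| ≤ B * Real.sqrt (a j) * Real.sqrt (b j)) :
    |∑ j, t j| ≤ B * Real.sqrt (∑ j, a j) * Real.sqrt (∑ j, b j) := by
  calc |∑ j, t j| ≤ ∑ j, |t j| := Finset.abs_sum_le_sum_abs _ _
    _ ≤ ∑ j, B * Real.sqrt (a j) * Real.sqrt (b j) := Finset.sum_le_sum fun j _ => h j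
    _ = B * ∑ j, Real.sqrt (a j) * Real.sqrt (b j) := by
        rw [Finset.mul_sum]
        exact Finset.sum_congr rfl fun j _ => by ring
    _ ≤ B * (Real.sqrt (∑ j, a j) * Real.sqrt (∑ j, b j)) :=
        mul_le_mul_of_nonneg_left (Real.sum_sqrt_mul_sqrt_le _ ha hb) hB
    _ = B * Real.sqrt (∑ j, a j) * Real.sqrt (∑ j, b j) := by ring

end Dictionary

/-! ## §2 Normalisation and separation bookkeeping -/

section Transport

variable {k N : ℕ}

/-- `√(E⁻¹A)·√(E⁻¹B) = E⁻¹·√A·√B` — the weight `ε^d` of (1.5) leaves the normalised pairing `⟨·,·⟩/(‖·‖‖·‖)`.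
[cite: Balaban1982Higgs1, (1.5) p.604] -/
theorem sqrt_scale {E A B : ℝ} (hE : 0 < E) :
    Real.sqrt (E⁻¹ * A) * Real.sqrt (E⁻¹ * B) = E⁻¹ * (Real.sqrt A * Real.sqrt B) := by
  rw [Real.sqrt_mul (inv_nonneg.2 hE.le), Real.sqrt_mul (inv_nonneg.2 hE.le)]
  have h := Real.mul_self_sqrt (inv_nonneg.2 hE.le)
  calc Real.sqrt E⁻¹ * Real.sqrt A * (Real.sqrt E⁻¹ * Real.sqrt B)
      = (Real.sqrt E⁻¹ * Real.sqrt E⁻¹) * (Real.sqrt A * Real.sqrt B) := by ring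
    _ = E⁻¹ * (Real.sqrt A * Real.sqrt B) := by rw [h]

/-- supports `≧ R` apart in (1.3) read on the level-`k` torus: `R/L^k ≦ distX`. [cite: Balaban1982Higgs1, (1.3) p.604] -/
theorem sep_transport (S : Shape P) (hk : k ≤ P.K) {u v : HiggsLattice.Site P 0 → Prop} {R : ℝ}
    (hsep : ∀ x x', u x → v x' → R ≤ (HiggsLattice.Site.tdist x x' : ℝ))
    (f f' : Site (setupAt S k) 0 → ℝ) (hf : ∀ z, f z ≠ 0 → u ((eSiteAt S hk (Nat.zero_le _)).symm z))
    (hf' : ∀ z', f' z' ≠ 0 → v ((eSiteAt S hk (Nat.zero_le _)).symm z')) :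
    ∀ z z', f z ≠ 0 → f' z' ≠ 0 → R / (P.L : ℝ) ^ k ≤ distX (setupAt S k) k z z' := by
  intro z z' hz hz'
  have hL : (0 : ℝ) < (P.L : ℝ) ^ k := pow_pos (by have := S.hL.2; exact_mod_cast (show 0 < P.L by omega)) k
  unfold distX
  rw [T_eq_tdist_symm S hk (Nat.zero_le _), setupAt_L, div_eq_inv_mul]
  exact mul_le_mul_of_nonneg_left (hsep _ _ (hf z hz) (hf' z' hz')) (inv_nonneg.mpr hL.le)

end Transport

end Literature.MathematicalPhysics.QuantumFieldTheory.Balaban1983to89.B1Cor23DictZeroFieldTorus
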